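import Mathlib
import Literature.RingTheory.PowerSeries.LaurentSeriesDerivation
import Literature.RingTheory.PowerSeries.LaurentSeriesConstants
import HarnessLib

/-!
# Stub `stub_taylorMorphism` (line `ax-schanuel-germs`, crux `LogPrimitiveNL`)

The `C^∞` Taylor morphism at `0` from real germs into the Laurent series field `ℝ⸨X⸩`:
`T f := Σₙ f⁽ⁿ⁾(0)/n! · Xⁿ`, realised as
`HahnSeries.ofPowerSeries ℤ ℝ (PowerSeries.mk fun n => iteratedDeriv n f 0 / n!)`.
It is local (depends only on the germ at `0`), additive and multiplicative on functions `C^∞`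
near `0` (general Leibniz rule against the Cauchy product), intertwines `deriv` with
`LaurentSeries.derivative`, sends constants to `HahnSeries.C c` and the identity to `X`, takes
values in power series, has constant coefficient `f 0`, and vanishes exactly on flat germs.
-/

noncomputable section

open Set Filter
open scoped ContDiff Topology LaurentSeries

namespace Summit.KontsevichZagierPeriods.LiouvilleUnfolding.LogPrimitiveNL.AxSchanuelGerms

/-- A function `C^∞` on a neighbourhood of `0` is `Cⁿ` at `0` for every finite `n`. -/
theorem taylor_contDiffAt_of_nhds {f : ℝ → ℝ} (hf : ∃ U ∈ 𝓝 (0 : ℝ), ContDiffOn ℝ ∞ f U)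
    (n : ℕ) : ContDiffAt ℝ n f 0 := by
  obtain ⟨U, hU, hfU⟩ := hf
  exact (hfU.contDiffAt hU).of_le (mod_cast le_top)

/-- Taylor series at `0` of a sum of `C^∞` germs: coefficientwise additivity. -/
theorem taylor_mk_add {f g : ℝ → ℝ} (hf : ∃ U ∈ 𝓝 (0 : ℝ), ContDiffOn ℝ ∞ f U)
    (hg : ∃ U ∈ 𝓝 (0 : ℝ), ContDiffOn ℝ ∞ g U) :
    (PowerSeries.mk fun n => iteratedDeriv n (f + g) 0 / (n.factorial : ℝ)) =
      (PowerSeries.mk fun n => iteratedDeriv n f 0 / (n.factorial : ℝ)) +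
        PowerSeries.mk fun n => iteratedDeriv n g 0 / (n.factorial : ℝ) := by
  ext n
  rw [map_add, PowerSeries.coeff_mk, PowerSeries.coeff_mk, PowerSeries.coeff_mk,
    iteratedDeriv_add (taylor_contDiffAt_of_nhds hf n) (taylor_contDiffAt_of_nhds hg n), add_div]

/-- Taylor series at `0` of a product of `C^∞` germs: the general Leibniz rule is the Cauchy
product of the Taylor series. -/
theorem taylor_mk_mul {f g : ℝ → ℝ} (hf : ∃ U ∈ 𝓝 (0 : ℝ), ContDiffOn ℝ ∞ f U)
    (hg : ∃ U ∈ 𝓝 (0 : ℝ), ContDiffOn ℝ ∞ g U) :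
    (PowerSeries.mk fun n => iteratedDeriv n (f * g) 0 / (n.factorial : ℝ)) =
      (PowerSeries.mk fun n => iteratedDeriv n f 0 / (n.factorial : ℝ)) *
        PowerSeries.mk fun n => iteratedDeriv n g 0 / (n.factorial : ℝ) := by
  ext n
  rw [PowerSeries.coeff_mk, PowerSeries.coeff_mul,
    iteratedDeriv_mul (taylor_contDiffAt_of_nhds hf n) (taylor_contDiffAt_of_nhds hg n),
    Finset.Nat.sum_antidiagonal_eq_sum_range_succ_mk, Finset.sum_div]
  refine Finset.sum_congr rfl fun i hi => ?_
  rw [PowerSeries.coeff_mk, PowerSeries.coeff_mk]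
  have hi' : i ≤ n := Nat.lt_succ_iff.mp (Finset.mem_range.mp hi)
  rw [Nat.cast_choose ℝ hi']
  have h1 : (i.factorial : ℝ) ≠ 0 := by positivity
  have h2 : ((n - i).factorial : ℝ) ≠ 0 := by positivity
  have h3 : (n.factorial : ℝ) ≠ 0 := by positivity
  field_simp

/-- Taylor series at `0` of the derivative: the formal derivative of the Taylor series
(`f⁽ⁿ⁺¹⁾(0)/n! = (n+1) · f⁽ⁿ⁺¹⁾(0)/(n+1)!`). No smoothness is needed. -/
theorem taylor_mk_deriv (f : ℝ → ℝ) :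
    (PowerSeries.mk fun n => iteratedDeriv n (deriv f) 0 / (n.factorial : ℝ)) =
      PowerSeries.derivative ℝ
        (PowerSeries.mk fun n => iteratedDeriv n f 0 / (n.factorial : ℝ)) := by
  ext n
  rw [PowerSeries.coeff_mk, PowerSeries.coeff_derivative, PowerSeries.coeff_mk,
    ← iteratedDeriv_succ', Nat.factorial_succ]
  push_cast
  have h1 : (n.factorial : ℝ) ≠ 0 := by positivity
  have h2 : ((n : ℝ) + 1) ≠ 0 := by positivity
  field_simp

/-- Taylor series at `0` of a constant function is the constant power series. -/
theorem taylor_mk_const (c : ℝ) :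
    (PowerSeries.mk fun n => iteratedDeriv n (fun _ : ℝ => c) 0 / (n.factorial : ℝ)) =
      PowerSeries.C c := by
  ext n
  rw [PowerSeries.coeff_mk, PowerSeries.coeff_C, iteratedDeriv_const]
  split_ifs with h
  · subst h
    simp
  · rw [zero_div]

/-- Taylor series at `0` of the identity function is `X`. -/
theorem taylor_mk_id :
    (PowerSeries.mk fun n => iteratedDeriv n (fun t : ℝ => t) 0 / (n.factorial : ℝ)) =
      PowerSeries.X := by
  ext n
  rw [PowerSeries.coeff_mk, PowerSeries.coeff_X, iteratedDeriv_fun_id_zero]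
  split_ifs with h
  · subst h
    simp
  · rw [zero_div]

/-- The Taylor series at `0` vanishes iff the germ is flat (all derivatives vanish at `0`). -/
theorem taylor_mk_eq_zero_iff (f : ℝ → ℝ) :
    (PowerSeries.mk fun n => iteratedDeriv n f 0 / (n.factorial : ℝ)) = 0 ↔
      ∀ n : ℕ, iteratedDeriv n f 0 = 0 := by
  rw [PowerSeries.ext_iff]
  refine forall_congr' fun n => ?_
  rw [PowerSeries.coeff_mk, map_zero, div_eq_zero_iff, or_iff_left]
  exact_mod_cast Nat.factorial_ne_zero n

/-- **Taylor morphism at `0`** (`C^∞` real germs `→ ℝ⸨X⸩`): there is a map `T` from real functions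
to Laurent series which depends only on the germ at `0`, is additive and multiplicative on functions
`C^∞` near `0`, intertwines `deriv` with `LaurentSeries.derivative`, sends constants to `C c` and the
identity to `X`, takes values in power series, has constant coefficient the value at `0`, and kills
exactly the FLAT germs (all derivatives at `0` vanish). (`T f = Σ f⁽ⁿ⁾(0)/n! Xⁿ`.) -/
theorem stub_taylorMorphism :
    ∃ T : (ℝ → ℝ) → ℝ⸨X⸩,
      (∀ f g : ℝ → ℝ, f =ᶠ[𝓝 0] g → T f = T g) ∧
      (∀ f g : ℝ → ℝ, (∃ U ∈ 𝓝 (0 : ℝ), ContDiffOn ℝ ∞ f U) →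
        (∃ U ∈ 𝓝 (0 : ℝ), ContDiffOn ℝ ∞ g U) →
          T (f + g) = T f + T g ∧ T (f * g) = T f * T g) ∧
      (∀ f : ℝ → ℝ, (∃ U ∈ 𝓝 (0 : ℝ), ContDiffOn ℝ ∞ f U) →
        T (deriv f) = LaurentSeries.derivative ℝ (T f)) ∧
      (∀ c : ℝ, T (fun _ => c) = HahnSeries.C c) ∧
      T (fun t => t) = HahnSeries.single 1 1 ∧
      (∀ f : ℝ → ℝ, ∃ p : PowerSeries ℝ, T f = HahnSeries.ofPowerSeries ℤ ℝ p) ∧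
      (∀ f : ℝ → ℝ, (T f).coeff 0 = f 0) ∧
      (∀ f : ℝ → ℝ, (∃ U ∈ 𝓝 (0 : ℝ), ContDiffOn ℝ ∞ f U) →
        (T f = 0 ↔ ∀ n : ℕ, iteratedDeriv n f 0 = 0)) := by
  refine ⟨fun f => HahnSeries.ofPowerSeries ℤ ℝ
      (PowerSeries.mk fun n => iteratedDeriv n f 0 / (n.factorial : ℝ)),
    fun f g hfg => ?_, fun f g hf hg => ⟨?_, ?_⟩, fun f _ => ?_, fun c => ?_, ?_,
    fun f => ⟨_, rfl⟩, fun f => ?_, fun f _ => ?_⟩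
  · -- locality
    beta_reduce
    exact congrArg (HahnSeries.ofPowerSeries ℤ ℝ) (PowerSeries.ext fun n => by
      rw [PowerSeries.coeff_mk, PowerSeries.coeff_mk, hfg.iteratedDeriv_eq n])
  · -- additivity
    beta_reduce
    rw [taylor_mk_add hf hg, map_add]
  · -- multiplicativity
    beta_reduce
    rw [taylor_mk_mul hf hg, map_mul]
  · -- derivative
    beta_reduce
    rw [taylor_mk_deriv, Literature.RingTheory.PowerSeries.derivative_coe_powerSeries]
  · -- constants
    beta_reduce
    rw [taylor_mk_const, HahnSeries.ofPowerSeries_C]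
  · -- identity
    beta_reduce
    rw [taylor_mk_id, HahnSeries.ofPowerSeries_X]
  · -- constant coefficient
    beta_reduce
    rw [show (0 : ℤ) = ((0 : ℕ) : ℤ) from rfl, HahnSeries.ofPowerSeries_apply_coeff,
      PowerSeries.coeff_mk, iteratedDeriv_zero, Nat.factorial_zero, Nat.cast_one, div_one]
  · -- kernel = flat germs
    beta_reduce
    rw [← taylor_mk_eq_zero_iff f, ← (HahnSeries.ofPowerSeries ℤ ℝ).map_zero,
      HahnSeries.ofPowerSeries_injective.eq_iff]

end Summit.KontsevichZagierPeriods.LiouvilleUnfolding.LogPrimitiveNL.AxSchanuelGerms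

end
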